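import Summits.HubbardSuperconductivity.HubbardSuperconductivity.Theorems.AnisotropyChordChordToOrderXY

/-!
# Route `AnisotropyChord` — assembly item

`Assembly` (stmt-HubbardSuperconductivity-8153): `ChordXY → SectorAnchorXY → DressHalfFilled →
Continuation → HubbardSuperconductivity`. The XY chord and the sector anchor give the half-filled
XY order (`chordToOrderXY_proof`, `Theorems/AnisotropyChordChordToOrderXY.lean`), which
`DressHalfFilled` turns into the Hubbard anchor `(U, δ, t₀, …)`, and `Continuation` into the
summit's matrix at `(U, δ)`. Bookkeeping.

Source: D. J. Scalapino, Phys. Rep. 250 (1995) 329, §2. No new definitions.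
-/

-- the mandated namespace `Summit.<Summit>.<Problem>.Theorems` repeats `HubbardSuperconductivity`
-- (single-problem summit, D-0017), which the `dupNamespace` linter flags on every declaration
set_option linter.dupNamespace false

namespace Summit.HubbardSuperconductivity.HubbardSuperconductivity.Theorems.AnisotropyChord

open Summit.HubbardSuperconductivity.HubbardSuperconductivity.Theses.AnisotropyChord

/-- **Assembly of route `AnisotropyChord`** (stmt-HubbardSuperconductivity-8153):
`ChordXY → SectorAnchorXY → DressHalfFilled → Continuation → HubbardSuperconductivity` — half-filled
XY order from the chord and the anchor, dressed to the Hubbard anchor, continued to the summit.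
Scalapino, Phys. Rep. 250 (1995) 329, §2. [folklore] -/
theorem anisotropyChord_assembly_proof :
    Summit.HubbardSuperconductivity.HubbardSuperconductivity.Theses.AnisotropyChord.Assembly := by
  intro hXY hSA hD hC
  obtain ⟨U, hU, δ, hδ, h⟩ := hD (chordToOrderXY_proof hXY hSA)
  exact ⟨U, hU, δ, hδ, fun N ψ hyp => hC U δ hU hδ h N ψ hyp⟩

end Summit.HubbardSuperconductivity.HubbardSuperconductivity.Theorems.AnisotropyChord
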